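import Literature.NumberTheory.EllipticCurves.Kato2004.KummerCupLevelClass
import HarnessLib

/-!
# The Kummer–cup class `κ_U(β) ∪ e`: push-forward along a homomorphism of torsion modules, linearity in the point,
# powers of the unit, and the CONJUGATION action `g · (κ_U(β) ∪_ζ e)` for `U ⊴ Γ_K`

Curve-generic, prime-generic Galois cohomology (number field / any field `K`, ANY Weierstrass curves `E, E′`, any level
`N`), completing T1b-1 `Kato2004/KummerCupLevelClass.lean` (`kummerCupLevelClass`, its additivity, `res`, `cor`, change of
level) by the three bricks the (B2′)-road of the `𝒞₇` genus route consumes (memo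
`Cruxes/EllipticUnitValueSevenOfGZK/K2C12KummerNonvanishing_g31.md` §1 (m5)–(m6), §3 L3; README-g30 §2(c) «functoriality in
`e` OWED»):

* §1 ★ `mapH1AddHom_kummerCupLevelClass` — for an additive `U`-equivariant `f : E[n] → E′[n′]` (same exponent `N`; e.g. an
  isogeny `α : E → E′` or an endomorphism `g₁ = φ|E[p]`), `f_*(κ_U(β) ∪_ζ e) = κ_U(β) ∪_ζ f(e)` (`f ∘ t_{ζ,e} = t_{ζ,f e}`);
* §2 `muSubgroupKummerCocycle_pow_apply` (`κ_U(β^m)(σ) = m • κ_U(β)(σ)`), ★ `kummerCupLevelClass_pow_eq_nsmul_point`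
  (`κ_U(β^m) ∪ e = κ_U(β) ∪ (m • e)`), `nsmul_eq_self_of_modEq` (`k • P = P` on `E[n]` for `k ≡ 1 (N)`) — all integer
  multipliers are read on POINTS and UNITS, never as scalars on `H¹`; `muToTorsionHom_injective_of_prime` and
  `kummerCupCocycle_apply_eq_zero_iff` (`N = p`, `e ≠ 0`: the COCYCLE `t_{ζ,e} ∘ κ_U(β)` vanishes at `σ` iff `σβ = β`);
* §3 ★ `conjMap_kummerCupLevelClass` — for `U` NORMAL in `Γ_K`, `g ∈ Γ_K` with `g ζ = ζ^a`, `b a ≡ 1 (mod N)`: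
  `g · (κ_U(β) ∪_ζ e) = κ_U((gβ)^b) ∪_ζ (g e)` (on cocycles `g · t_{ζ,e}(σβ/β)` vs `t_{ζ,ge}` of the conjugate Kummer cocycle,
  T1a `conj_pullback_muSubgroupKummerCocycle`; the exponent `b = χ_cyc(g)⁻¹ mod N` records that `t_{ζ,e}` is NOT `Γ_K`-equivariant;
  also as an identity of COCYCLES, `conj_pullback_kummerCupCocycle`),
  and the CHARACTER form `conjMap_kummerCupLevelClass_of_smul_eq` (`g e = c • e` ⇒ `g · (κ_U(β) ∪ e) = κ_U((gβ)^{bc}) ∪ e`).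

With `ContinuousCorestrictionResNormal.resLe_coresLe_eq_sum_conjMap` (`res ∘ cor = Σ conj`) these give the restriction to a
normal subgroup `H` of a corestricted Kummer–cup class as the Kummer–cup class of a TWISTED NORM `∏ (g_y β)^{b_y c_y}`
(`kummerCupLevelClass_mul`).
Theorems only: no definition, no named fact, no instance, no `sorry`.

## References
* K. Kato, Astérisque 295 (2004), §8.2 (p. 181), (15.6.1) (p. 253), (15.12.1) (p. 263), 15.14 (p. 264). [Kato2004Asterisque]
* J.-P. Serre, *Local Fields* (1979), VII §5 (action of `G/H` on `H^q(H, A)`); *Galois Cohomology* (1997), I §2.2, §2.5, II §1.2.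
  [SerreLocalFields1979] [SerreGaloisCohomology1997]
* K. Rubin, *Euler Systems* (2000), VI §1, App. B.2. [Rubin2000]
* Tree: `Kato2004/KummerCupLevelClass.lean` (T1b-1), `GaloisRepresentations/SubgroupKummerMu.lean` (T1a:
  `conj_pullback_muSubgroupKummerCocycle`, `smul_mem_subgroupKummerUnits_of_normal`, `muSubgroupKummerClass_inv`),
  `Kato2004/IwasawaH1Reduction.lean` (`mapH1AddHom`, `mapH1AddHom_oneCocycleClass`), `GaloisRepresentations/ContinuousCorestriction.lean`
  (`conjMap`, `conj_pullback_apply`).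
-/

noncomputable section

universe u

open scoped NumberField
open Field IsDedekindDomain
open Literature.NumberTheory.GaloisRepresentations
open Literature.NumberTheory.EllipticCurves
open WeierstrassCurve (geomPoints geomTorsion)

namespace Literature.NumberTheory.EllipticCurves.Kato2004

open DiscreteGaloisModule

section Conj

variable {K : Type} [Field K] (E : WeierstrassCurve K) (N : ℕ) [NeZero N]
  (U : Subgroup (absoluteGaloisGroup K)) (ζ : (AlgebraicClosure K)ˣ) (hζ : IsPrimitiveRoot ζ N)
  {n : ℤ} (hn : (N : ℤ) = n) (e : geomTorsion E n)

/-! ## §1 Push-forward along a homomorphism of torsion modules: `f_*(κ_U(β) ∪_ζ e) = κ_U(β) ∪_ζ f(e)` -/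

/-- `f ∘ t_{ζ,e} = t_{ζ, f e}` for any additive `f : E[n] → E′[n′]` (both send `ζ` to `f e`).
[cite: Kato2004Asterisque, (15.12.1) (p. 263)] -/
theorem comp_muToTorsionHom_of_map {E' : WeierstrassCurve K} {n' : ℤ} (hn' : (N : ℤ) = n')
    (f : geomTorsion E n →+ geomTorsion E' n') :
    f.comp (muToTorsionHom E N ζ hζ hn e) = muToTorsionHom E' N ζ hζ hn' (f e) := by
  refine MuCarrier.addMonoidHom_ext_of_isPrimitiveRoot hζ ?_
  rw [AddMonoidHom.comp_apply, muToTorsionHom_gen, muToTorsionHom_gen]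

/-- A `U`-equivariant `f` maps a `U`-fixed point to a `U`-fixed point. [cite: SerreGaloisCohomology1997, I §2.2] -/
theorem smul_map_eq_of_equivariant (hUe : ∀ σ : U, (σ : absoluteGaloisGroup K) • e = e)
    {E' : WeierstrassCurve K} {n' : ℤ} (f : geomTorsion E n →+ geomTorsion E' n')
    (hfU : ∀ (g : U) (P : geomTorsion E n),
      f ((subgroupRep (E.torsionGaloisModule n).toTopRep U).ρ g P) =
        (subgroupRep (E'.torsionGaloisModule n').toTopRep U).ρ g (f P))
    (σ : U) : (σ : absoluteGaloisGroup K) • f e = f e := by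
  have h := hfU σ e
  change f ((σ : absoluteGaloisGroup K) • e) = (σ : absoluteGaloisGroup K) • f e at h
  rw [hUe σ] at h
  exact h.symm

/-- ★ **Push-forward of the Kummer–cup class along a homomorphism of torsion modules**: for an additive, `U`-equivariant
`f : E[n] → E′[n′]` (same exponent `N`), `f_*(κ_U(β) ∪_ζ e) = κ_U(β) ∪_ζ f(e)` in `H¹(U, E′[n′])`.  Instances: an isogeny
`α : E → E′` on `N`-torsion (`α_*` of Kato's layer classes), an endomorphism lift `g₁ = φ|E[p]` (the `π`-test of T3a).
[cite: Kato2004Asterisque, (15.12.1) (p. 263) and 15.14 (p. 264)] [cite: SerreGaloisCohomology1997, I §2.2] -/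
theorem mapH1AddHom_kummerCupLevelClass (hUζ : ∀ σ : U, (σ : absoluteGaloisGroup K) • ζ = ζ)
    (hUe : ∀ σ : U, (σ : absoluteGaloisGroup K) • e = e) {E' : WeierstrassCurve K} {n' : ℤ} (hn' : (N : ℤ) = n')
    (f : geomTorsion E n →+ geomTorsion E' n')
    (hfU : ∀ (g : U) (P : geomTorsion E n),
      f ((subgroupRep (E.torsionGaloisModule n).toTopRep U).ρ g P) =
        (subgroupRep (E'.torsionGaloisModule n').toTopRep U).ρ g (f P))
    (hUe' : ∀ σ : U, (σ : absoluteGaloisGroup K) • f e = f e) (β : subgroupKummerUnits K N U) :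
    mapH1AddHom (subgroupRep (E.torsionGaloisModule n).toTopRep U) (subgroupRep (E'.torsionGaloisModule n').toTopRep U)
        f continuous_of_discreteTopology hfU (kummerCupLevelClass E N U ζ hζ hn e hUζ hUe β) =
      kummerCupLevelClass E' N U ζ hζ hn' (f e) hUζ hUe' β := by
  rw [kummerCupLevelClass_eq_oneCocycleClass, kummerCupLevelClass_eq_oneCocycleClass, mapH1AddHom_oneCocycleClass]
  refine congrArg _ (Subtype.ext (ContinuousMap.ext fun σ ↦ ?_))
  rw [contOneCocycles.pushAddHom_apply, contOneCocycles.pushAddHom_apply, contOneCocycles.pushAddHom_apply,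
    ← AddMonoidHom.comp_apply, comp_muToTorsionHom_of_map E N ζ hζ hn e hn' f]

/-! ## §2 Powers of the unit ↔ multiples of the point (no scalars on `H¹` are used: everything is read on torsion points) -/

/-- `t_{ζ, m • e} = m • t_{ζ,e}` pointwise (`m ∈ ℕ`). [cite: Kato2004Asterisque, (15.12.1) (p. 263)] -/
theorem muToTorsionHom_nsmul_apply (m : ℕ) (v : MuCarrier K N) :
    muToTorsionHom E N ζ hζ hn (m • e) v = m • muToTorsionHom E N ζ hζ hn e v := by
  obtain ⟨i, -, rfl⟩ := MuCarrier.exists_eq_nsmul_of_isPrimitiveRoot hζ v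
  rw [map_nsmul, map_nsmul, muToTorsionHom_gen, muToTorsionHom_gen, smul_comm]

omit [NeZero N] in
/-- The Kummer cocycle of a power: `κ_U(β^m)(σ) = m • κ_U(β)(σ)` (additive notation of `μ_N`).
[cite: SerreGaloisCohomology1997, II §1.2] -/
theorem muSubgroupKummerCocycle_pow_apply (β : subgroupKummerUnits K N U) (m : ℕ) (σ : U) :
    (muSubgroupKummerCocycle K N U (β ^ m)).1 σ = m • (muSubgroupKummerCocycle K N U β).1 σ := by
  induction m with
  | zero => rw [pow_zero, muSubgroupKummerCocycle_one, zero_smul]; rfl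
  | succ m ih =>
    rw [pow_succ, muSubgroupKummerCocycle_mul, Submodule.coe_add, ContinuousMap.add_apply, ih, add_smul, one_smul]

/-- A `U`-fixed point has `U`-fixed multiples (the action is additive). [cite: SerreGaloisCohomology1997, I §2.2] -/
theorem smul_nsmul_eq_of_smul_eq (hUe : ∀ σ : U, (σ : absoluteGaloisGroup K) • e = e) (m : ℕ) (σ : U) :
    (σ : absoluteGaloisGroup K) • (m • e) = m • e := by
  change (E.torsionGaloisModule n).toTopRep.ρ (σ : absoluteGaloisGroup K) (m • e) = m • e
  rw [map_nsmul]
  exact congrArg (m • ·) (hUe σ)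

/-- ★ **Powers of the unit are multiples of the point**: `κ_U(β^m) ∪_ζ e = κ_U(β) ∪_ζ (m • e)` (`m ∈ ℕ`).
[cite: Kato2004Asterisque, (15.12.1) (p. 263)] [cite: SerreGaloisCohomology1997, II §1.2] -/
theorem kummerCupLevelClass_pow_eq_nsmul_point (hUζ : ∀ σ : U, (σ : absoluteGaloisGroup K) • ζ = ζ)
    (hUe : ∀ σ : U, (σ : absoluteGaloisGroup K) • e = e) (β : subgroupKummerUnits K N U) (m : ℕ) :
    kummerCupLevelClass E N U ζ hζ hn e hUζ hUe (β ^ m) =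
      kummerCupLevelClass E N U ζ hζ hn (m • e) hUζ (smul_nsmul_eq_of_smul_eq E U e hUe m) β := by
  rw [kummerCupLevelClass_eq_oneCocycleClass, kummerCupLevelClass_eq_oneCocycleClass]
  refine congrArg _ (Subtype.ext (ContinuousMap.ext fun σ ↦ ?_))
  rw [contOneCocycles.pushAddHom_apply, contOneCocycles.pushAddHom_apply, muSubgroupKummerCocycle_pow_apply, map_nsmul,
    muToTorsionHom_nsmul_apply]

omit [NeZero N] in
include hn in
/-- `k • P = P` on `E[n]` whenever `k ≡ 1 (mod N)` (`N • P = 0`: `E[N]` is a `ℤ/N`-module). [cite: SerreGaloisCohomology1997, II §1.2] -/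
theorem nsmul_eq_self_of_modEq (P : geomTorsion E n) {k : ℕ} (hk : k ≡ 1 [MOD N]) : k • P = P := by
  have hN : N • P = 0 := Subtype.ext (by
    rw [AddSubmonoidClass.coe_nsmul, ZeroMemClass.coe_zero, ← natCast_zsmul, hn]
    exact (Submodule.mem_torsionBy_iff (R := ℤ) _ _).mp P.2)
  rcases Nat.lt_or_ge k 1 with hlt | hle
  · have hk0 : k = 0 := by omega
    subst hk0
    -- `0 ≡ 1 (mod N)` forces `N = 1`, so `P = 1 • P = N • P = 0 = 0 • P`
    have hN1 : N = 1 := Nat.eq_one_of_dvd_one ((Nat.modEq_iff_dvd' (Nat.zero_le 1)).mp hk)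
    rw [zero_smul, ← hN, hN1, one_smul]
  · obtain ⟨q, hq⟩ := (Nat.modEq_iff_dvd' hle).mp hk.symm
    have hk' : k = 1 + N * q := by omega
    rw [hk', add_smul, one_smul, mul_comm, mul_smul, hN, smul_zero, add_zero]

/-- Congruence in the point (the `U`-invariance witnesses are proofs). [cite: Kato2004Asterisque, (15.12.1) (p. 263)] -/
theorem kummerCupLevelClass_congr_point (hUζ : ∀ σ : U, (σ : absoluteGaloisGroup K) • ζ = ζ) {e₁ e₂ : geomTorsion E n}
    (h : e₁ = e₂) (h₁ : ∀ σ : U, (σ : absoluteGaloisGroup K) • e₁ = e₁) (h₂ : ∀ σ : U, (σ : absoluteGaloisGroup K) • e₂ = e₂)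
    (γ : subgroupKummerUnits K N U) :
    kummerCupLevelClass E N U ζ hζ hn e₁ hUζ h₁ γ = kummerCupLevelClass E N U ζ hζ hn e₂ hUζ h₂ γ := by
  subst h
  rfl

/-- **`t_{ζ,e}` is injective when `N = p` is prime and `e ≠ 0`** (`μ_p → E[p]` is then an isomorphism onto the line
`(ℤ/p) e`): a Kummer–cup COCYCLE `t_{ζ,e} ∘ κ_U(β)` vanishes identically iff `κ_U(β)` does, i.e. iff `β` is `U`-fixed.
[cite: Kato2004Asterisque, (15.12.1) (p. 263)] [cite: SerreGaloisCohomology1997, II §1.2] -/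
theorem muToTorsionHom_injective_of_prime (hp : N.Prime) (he : e ≠ 0) :
    Function.Injective (muToTorsionHom E N ζ hζ hn e) := by
  refine (injective_iff_map_eq_zero _).mpr fun v hv ↦ ?_
  obtain ⟨i, hi, rfl⟩ := MuCarrier.exists_eq_nsmul_of_isPrimitiveRoot hζ v
  rw [map_nsmul, muToTorsionHom_gen] at hv
  -- `i • e = 0`, `N • e = 0`, `N` prime, `e ≠ 0` ⇒ `N ∣ i` ⇒ `i = 0`
  have hN : N • e = 0 := Subtype.ext (by
    rw [AddSubmonoidClass.coe_nsmul, ZeroMemClass.coe_zero, ← natCast_zsmul, hn]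
    exact (Submodule.mem_torsionBy_iff (R := ℤ) _ _).mp e.2)
  have hord : addOrderOf e = N := by
    rcases (Nat.dvd_prime hp).mp (addOrderOf_dvd_of_nsmul_eq_zero hN) with h1 | h1
    · exact absurd (AddMonoid.addOrderOf_eq_one_iff.mp h1) he
    · exact h1
  have hdvd : N ∣ i := hord ▸ addOrderOf_dvd_of_nsmul_eq_zero hv
  obtain rfl : i = 0 := Nat.eq_zero_of_dvd_of_lt hdvd hi
  rw [zero_smul]

/-- Hence: the Kummer–cup cocycle `t_{ζ,e} ∘ κ_U(β)` (`N = p` prime, `e ≠ 0`) vanishes at `σ` iff `σ β = β`.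
[cite: Kato2004Asterisque, (15.12.1) (p. 263)] [cite: SerreGaloisCohomology1997, II §1.2] -/
theorem kummerCupCocycle_apply_eq_zero_iff (hUζ : ∀ σ : U, (σ : absoluteGaloisGroup K) • ζ = ζ)
    (hUe : ∀ σ : U, (σ : absoluteGaloisGroup K) • e = e) (hp : N.Prime) (he : e ≠ 0)
    (β : subgroupKummerUnits K N U) (σ : U) :
    (contOneCocycles.pushAddHom (Y := subgroupRep (E.torsionGaloisModule n).toTopRep U)
        (muToTorsionHom E N ζ hζ hn e) continuous_of_discreteTopology
        (muToTorsionHom_subgroupRep E N U ζ hζ hn e hUζ hUe) (muSubgroupKummerCocycle K N U β)).1 σ = 0 ↔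
      (σ : absoluteGaloisGroup K) • (β : (AlgebraicClosure K)ˣ) = β := by
  rw [contOneCocycles.pushAddHom_apply, ← map_zero (muToTorsionHom E N ζ hζ hn e),
    (muToTorsionHom_injective_of_prime E N ζ hζ hn e hp he).eq_iff, ← (muVal_injective K N).eq_iff,
    muVal_muSubgroupKummerCocycle_apply, muVal_zero, div_eq_one]

/-! ## §3 The conjugation action for `U` normal in `Γ_K` -/

variable [U.Normal]

/-- For `U ⊴ Γ_K`, `g e` is again `U`-fixed (`σ(ge) = g((g⁻¹σg)e)`). [cite: SerreLocalFields1979, VII §5] -/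
theorem smul_smul_eq_of_forall_smul_eq (hUe : ∀ σ : U, (σ : absoluteGaloisGroup K) • e = e) (g : absoluteGaloisGroup K)
    (σ : U) : (σ : absoluteGaloisGroup K) • (g • e) = g • e := by
  have hmem : g⁻¹ * (σ : absoluteGaloisGroup K) * g ∈ U := by
    simpa using Subgroup.Normal.conj_mem inferInstance (σ : absoluteGaloisGroup K) σ.2 g⁻¹
  have h := hUe ⟨_, hmem⟩
  change (g⁻¹ * (σ : absoluteGaloisGroup K) * g) • e = e at h
  calc (σ : absoluteGaloisGroup K) • (g • e) = g • ((g⁻¹ * (σ : absoluteGaloisGroup K) * g) • e) := by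
        rw [smul_smul, smul_smul, ← mul_assoc, ← mul_assoc, mul_inv_cancel, one_mul]
    _ = g • e := by rw [h]

/-- The Galois action on `E[n]` commutes with integer multiples (`Γ_K` acts by group automorphisms). [cite: SerreGaloisCohomology1997, I §2.2] -/
theorem galois_smul_nsmul (g : absoluteGaloisGroup K) (k : ℕ) (P : geomTorsion E n) : g • (k • P) = k • (g • P) := by
  change (E.torsionGaloisModule n).toTopRep.ρ g (k • P) = k • (E.torsionGaloisModule n).toTopRep.ρ g P
  exact map_nsmul _ _ _

/-- The cocycle-level identity behind the conjugation formula: for `g ζ = ζ^a` and `v ∈ μ_N`,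
`a • (g · t_{ζ,e}(v)) = t_{ζ, g e}(g v)` (`g ζ^i = ζ^{ai}`). [cite: Kato2004Asterisque, (15.12.1) (p. 263)] [cite: SerreLocalFields1979, VII §5] -/
theorem nsmul_smul_muToTorsionHom (g : absoluteGaloisGroup K) {a : ℕ} (ha : g • ζ = ζ ^ a) (v : MuCarrier K N) :
    a • (g • muToTorsionHom E N ζ hζ hn e v) = muToTorsionHom E N ζ hζ hn (g • e) ((mu K N).toTopRep.ρ g v) := by
  obtain ⟨i, -, rfl⟩ := MuCarrier.exists_eq_nsmul_of_isPrimitiveRoot hζ v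
  have hgζ : (mu K N).toTopRep.ρ g (MuCarrier.ofRootsOfUnity ⟨ζ, hζ.mem_rootsOfUnity⟩) =
      MuCarrier.ofRootsOfUnity ⟨ζ ^ a, pow_mem hζ.mem_rootsOfUnity a⟩ :=
    muVal_injective K N (by
      change muVal K N ((mu K N).toContRepresentation g _) = _
      rw [muVal_toContRepresentation_apply, muVal_ofRootsOfUnity, muVal_ofRootsOfUnity]
      exact ha)
  rw [map_nsmul, map_nsmul, hgζ, map_nsmul, muToTorsionHom_gen, muToTorsionHom_pow, galois_smul_nsmul, smul_comm]

/-- **Conjugation, COCYCLE level**: for `U ⊴ Γ_K`, `g ζ = ζ^a`, `b a ≡ 1 (mod N)`, the conjugate `x ↦ g · t_{ζ,e}(κ_U(β)(g⁻¹xg))`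
of the Kummer–cup cocycle IS the Kummer–cup cocycle `t_{ζ,ge} ∘ κ_U((gβ)^b)` — an identity of cocycles, not only of classes
(consumers testing the vanishing of a transfer cocycle use this form). [cite: SerreLocalFields1979, VII §5]
[cite: Kato2004Asterisque, (15.12.1) (p. 263)] -/
theorem conj_pullback_kummerCupCocycle (hUζ : ∀ σ : U, (σ : absoluteGaloisGroup K) • ζ = ζ)
    (hUe : ∀ σ : U, (σ : absoluteGaloisGroup K) • e = e) (g : absoluteGaloisGroup K) {a b : ℕ} (ha : g • ζ = ζ ^ a)
    (hb : b * a ≡ 1 [MOD N]) (β : subgroupKummerUnits K N U) :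
    contOneCocycles.pullback (subgroupConj U g) (conjRepHom (E.torsionGaloisModule n).toTopRep U g)
        (contOneCocycles.pushAddHom (muToTorsionHom E N ζ hζ hn e) continuous_of_discreteTopology
          (muToTorsionHom_subgroupRep E N U ζ hζ hn e hUζ hUe) (muSubgroupKummerCocycle K N U β)) =
      contOneCocycles.pushAddHom (muToTorsionHom E N ζ hζ hn (g • e)) continuous_of_discreteTopology
        (muToTorsionHom_subgroupRep E N U ζ hζ hn (g • e) hUζ (smul_smul_eq_of_forall_smul_eq E U e hUe g))
        (muSubgroupKummerCocycle K N U
          (⟨g • (β : (AlgebraicClosure K)ˣ), smul_mem_subgroupKummerUnits_of_normal g β.2⟩ ^ b)) := by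
  refine Subtype.ext (ContinuousMap.ext fun x ↦ ?_)
  rw [conj_pullback_apply, contOneCocycles.pushAddHom_apply, contOneCocycles.pushAddHom_apply,
    muSubgroupKummerCocycle_pow_apply, map_nsmul, ← conj_pullback_muSubgroupKummerCocycle, conj_pullback_apply,
    ← nsmul_smul_muToTorsionHom E N ζ hζ hn e g ha, smul_smul]
  exact (nsmul_eq_self_of_modEq E N hn _ hb).symm

/-- ★ **The conjugation action on the Kummer–cup class**: for `U ⊴ Γ_K`, `g ∈ Γ_K` with `g ζ = ζ^a` and `b a ≡ 1 (mod N)`,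
`g · (κ_U(β) ∪_ζ e) = κ_U((g β)^b) ∪_ζ (g e)` in `H¹(U, E[n])` (`conjMap`; `g β` is a Kummer unit of `U` by normality).
The exponent `b = χ_cyc(g)⁻¹ mod N` is the price of `t_{ζ,e}` being only `U`-equivariant.
[cite: SerreLocalFields1979, VII §5] [cite: Kato2004Asterisque, (15.12.1) (p. 263) and 15.14 (p. 264)] -/
theorem conjMap_kummerCupLevelClass (hUζ : ∀ σ : U, (σ : absoluteGaloisGroup K) • ζ = ζ)
    (hUe : ∀ σ : U, (σ : absoluteGaloisGroup K) • e = e) (g : absoluteGaloisGroup K) {a b : ℕ} (ha : g • ζ = ζ ^ a)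
    (hb : b * a ≡ 1 [MOD N]) (β : subgroupKummerUnits K N U) :
    conjMap (E.torsionGaloisModule n).toTopRep U g 1 (kummerCupLevelClass E N U ζ hζ hn e hUζ hUe β) =
      kummerCupLevelClass E N U ζ hζ hn (g • e) hUζ (smul_smul_eq_of_forall_smul_eq E U e hUe g)
        (⟨g • (β : (AlgebraicClosure K)ˣ), smul_mem_subgroupKummerUnits_of_normal g β.2⟩ ^ b) := by
  rw [kummerCupLevelClass_eq_oneCocycleClass, kummerCupLevelClass_eq_oneCocycleClass, conjMap_oneCocycleClass,
    conj_pullback_kummerCupCocycle E N U ζ hζ hn e hUζ hUe g ha hb β]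

/-- **Character form**: if moreover `g e = c • e` (`e` spans a `Γ_K`-stable line with character `c`), then
`g · (κ_U(β) ∪_ζ e) = κ_U((g β)^{b c}) ∪_ζ e`. [cite: SerreLocalFields1979, VII §5] [cite: Kato2004Asterisque, 15.14 (p. 264)] -/
theorem conjMap_kummerCupLevelClass_of_smul_eq (hUζ : ∀ σ : U, (σ : absoluteGaloisGroup K) • ζ = ζ)
    (hUe : ∀ σ : U, (σ : absoluteGaloisGroup K) • e = e) (g : absoluteGaloisGroup K) {a b : ℕ} (ha : g • ζ = ζ ^ a)
    (hb : b * a ≡ 1 [MOD N]) {c : ℕ} (hc : g • e = c • e) (β : subgroupKummerUnits K N U) :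
    conjMap (E.torsionGaloisModule n).toTopRep U g 1 (kummerCupLevelClass E N U ζ hζ hn e hUζ hUe β) =
      kummerCupLevelClass E N U ζ hζ hn e hUζ hUe
        (⟨g • (β : (AlgebraicClosure K)ˣ), smul_mem_subgroupKummerUnits_of_normal g β.2⟩ ^ (b * c)) := by
  have h1 := conjMap_kummerCupLevelClass E N U ζ hζ hn e hUζ hUe g ha hb β
  rw [h1, pow_mul, kummerCupLevelClass_pow_eq_nsmul_point E N U ζ hζ hn e hUζ hUe
    (⟨g • (β : (AlgebraicClosure K)ˣ), smul_mem_subgroupKummerUnits_of_normal g β.2⟩ ^ b) c]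
  exact kummerCupLevelClass_congr_point E N U ζ hζ hn hUζ hc _ _ _

end Conj


end Literature.NumberTheory.EllipticCurves.Kato2004

end
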